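import Literature.Combinatorics.Optimization.BlockPsdLiftPolar
import Mathlib.Analysis.LocallyConvex.Separation
import Mathlib.Analysis.Normed.Module.FiniteDimension
import HarnessLib

/-!
# Duals of `(S^d_+)^r`-lifted pointed full-dimensional closed convex cones are `(S^d_+)^r`-lifted
# (Averkov 2019, (2.1)–(2.2) via Thm. 19; Gouveia–Parrilo–Thomas 2013) — PROVED

G. Averkov, *Optimal size of linear matrix inequalities in semidefinite approaches to polynomial
optimization*, SIAM J. Appl. Algebra Geom. 3 (2019) = arXiv:1806.08656 [cite: Averkov2019] (held text
`paper:arxiv-1806.08656`). §2.1 (p06), verbatim: "Results from [GPT:2013] imply that `sxc(C)` and `sxd(C)` are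
invariant under duality of cones: if `C ⊆ ℝ^n` is a `n`-dimensional pointed closed convex cone, then
(2.1) `sxc(C) = sxc(C^*)`, (2.2) `sxd(C) = sxd(C^*)`, where `C^*` is the dual cone of `C`", with
`C^* := {y : ⟨x, y⟩ ≥ 0 for all x ∈ C}` (§3.2, p08) and "`S` has a `K`-lift" iff
`S = π(K ∩ H)`, `H` affine, `π` linear (§1.1, p03); §3.3 (p08): "**Theorem 19** (Gouveia et al.). Let
`C ⊆ ℝⁿ` be a closed convex cone and let `K = (S^k_+)^m`. Then the following conditions are equivalent:
(i) `C` has a `K`-lift. (ii) For every `x ∈ C` there exist `A_x ∈ K` and for every `y ∈ C^*` there exists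
`B_y ∈ K` such that `⟨x, y⟩ = ⟨A_x, B_y⟩` holds for all `x ∈ C` and `y ∈ C^*`"; "**Remark 20.** One can
rephrase the results about `K`-lifts of `n`-dimensional compact convex sets from [GPT:2013] as results
about `K`-lifts of `n`-dimensional pointed closed convex cones … If `C` is not full-dimensional or not
pointed, then passing to appropriate coordinates, we can assume `C = C_0 × ℝ^s × {0}^t` …";
"**Remark 21.** Equalities (2.1) and (2.2) follow from Theorem 19." §3.2 (p08): "We call a convex cone `C`
in `ℝⁿ` pointed if there exists `u ∈ ℝⁿ ∖ {0}` with `⟨u, x⟩ ≥ 0` for all `x ∈ C` and such that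
`{x ∈ C : ⟨u, x⟩ = 0} = {0}`. If `C` is pointed, and `u` a vector as above, then `{x ∈ C : ⟨u, x⟩ = 1}` is a
bounded affine slice of `C`."

This file PROVES (2.1)–(2.2) for the cones of Remark 20's main case — POINTED closed convex cones with
NON-EMPTY INTERIOR in `ℝ^V` (the reduction of the general case, `C = C_0 × ℝ^s × {0}^t`, is not done here):

* `hasBlockPsdLift_dualCone` — if such a cone `C` has an `(S^d_+)^r`-lift then so does `C^*`, with the SAME
  `d` and `r`. Printed route (Remark 20: pass to the bounded slices): `B = C ∩ {⟨u, ·⟩ = 1}` is bounded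
  (`exists_pos_mul_norm_le_of_pointed`: pointed + closed ⇒ `c‖x‖ ≤ ⟨u, x⟩` on `C`, by compactness of
  `C ∩` sphere) and `(S^d_+)^r`-lifted; the tree's "lift ⇒ factorization" theorem
  (`HasBlockPsdLift.hasPsdPowerFactorization_slack`, GPT Thm. 2.4) factorizes `⟨x, y⟩` on `B × B'`,
  `B' = C^* ∩ {⟨x₀, ·⟩ = 1}` (`x₀ ∈ int C`), through `(S^d_+)^r` — this is Theorem 19 (i) ⇒ (ii) on the
  slices; transposing and feeding "factorization ⇒ lift" (`exists_hasBlockPsdLift_between`) with the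
  bounded `Q = {y : ⟨x, y⟩ ≥ 0 ∀ x ∈ B, ⟨x₀, y⟩ = 1} = B'` gives an `(S^d_+)^r`-lift of `B'`; and
  `HasBlockPsdLift.coneHull` (homogenisation keeps `(S^d_+)^r`-lifts: the cone `{t y : t ≥ 0, y ∈ B'}`
  over a bounded lifted set avoiding `0` is lifted by `W = ℝX₁ + dir L` — the block version of the tree's
  `HasPsdLift.coneOver`) returns to `C^* = cone(B')`.
* `dualCone_dualCone` — `(C^*)^* = C` for a closed convex cone (Averkov §3.2: "`(X^*)^* = cl(cone(X))`"),
  by Mathlib's geometric Hahn–Banach; with `mem_interior_dualCone_of_pointed` and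
  `dualCone_pointed_of_interior` (pointed ⟺ dual full-dimensional) this gives
  **`hasBlockPsdLift_dualCone_iff`: `C^*` has an `(S^d_+)^r`-lift iff `C` does** — so `sxc(C^*) = sxc(C)`
  (`r = 1`) and `sxd(C^*) = sxd(C)` for pointed full-dimensional closed convex cones, (2.1)–(2.2).

Vocabulary: `dualCone C = {y | ∀ x ∈ C, 0 ≤ x ⬝ᵥ y}` on `V → ℝ` (dot product), `coneHull S = {t • y}`,
`HasBlockPsdLift` (`BlockPsdLiftFactorization.lean`). NOT here: non-pointed or lower-dimensional cones
(e.g. the tree's `copositiveCone k`, which in the non-symmetric convention `IsCopositive` contains all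
antisymmetric matrices and is not pointed, and `completelyPositiveCone k ⊆ Sym_k`, not full-dimensional in
`ℝ^{k×k}`): for those (2.2) needs Remark 20's splitting. No named fact, no sorry.
-/

noncomputable section

open Matrix Finset Metric
open scoped MatrixOrder

namespace Literature.Combinatorics.Optimization

open FixedSizePsdRank (HasPsdPowerFactorization)

variable {V : Type*} [Fintype V]

/-! ### §1 Dual cones and cone hulls in `ℝ^V` -/

/-- **The conic dual** `C^* = {y : ⟨x, y⟩ ≥ 0 ∀ x ∈ C}` (dot product of `ℝ^V`). [cite: Averkov2019, §3.2 (p08)] -/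
def dualCone (C : Set (V → ℝ)) : Set (V → ℝ) := {y | ∀ x ∈ C, 0 ≤ x ⬝ᵥ y}

/-- Membership in the dual cone. [cite: Averkov2019, §3.2 (p08)] -/
theorem mem_dualCone_iff {C : Set (V → ℝ)} {y : V → ℝ} : y ∈ dualCone C ↔ ∀ x ∈ C, 0 ≤ x ⬝ᵥ y := Iff.rfl

/-- The dual cone is closed. [cite: Averkov2019, §3.2 (p08)] -/
theorem isClosed_dualCone (C : Set (V → ℝ)) : IsClosed (dualCone C) := by
  have : dualCone C = ⋂ x ∈ C, {y : V → ℝ | 0 ≤ x ⬝ᵥ y} := by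
    ext y; simp [dualCone]
  rw [this]
  refine isClosed_biInter fun x _ => ?_
  exact isClosed_le continuous_const (Continuous.dotProduct continuous_const continuous_id)

/-- The dual cone is closed under nonnegative scaling. [cite: Averkov2019, §3.2 (p08)] -/
theorem smul_mem_dualCone {C : Set (V → ℝ)} {y : V → ℝ} (hy : y ∈ dualCone C) {t : ℝ} (ht : 0 ≤ t) :
    t • y ∈ dualCone C := fun x hx => by
  rw [dotProduct_smul, smul_eq_mul]; exact mul_nonneg ht (hy x hx)

/-- The dual cone is closed under addition. [cite: Averkov2019, §3.2 (p08)] -/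
theorem add_mem_dualCone {C : Set (V → ℝ)} {y z : V → ℝ} (hy : y ∈ dualCone C) (hz : z ∈ dualCone C) :
    y + z ∈ dualCone C := fun x hx => by
  rw [dotProduct_add]; exact add_nonneg (hy x hx) (hz x hx)

/-- The dual cone is convex. [cite: Averkov2019, §3.2 (p08)] -/
theorem convex_dualCone (C : Set (V → ℝ)) : Convex ℝ (dualCone C) := by
  intro y hy z hz a b ha hb _
  exact add_mem_dualCone (smul_mem_dualCone hy ha) (smul_mem_dualCone hz hb)

/-- `C ⊆ (C^*)^*`. [cite: Averkov2019, §3.2 (p08, "(X^*)^* = cl(cone(X))")] -/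
theorem subset_dualCone_dualCone (C : Set (V → ℝ)) : C ⊆ dualCone (dualCone C) := fun x hx y hy => by
  rw [dotProduct_comm]; exact hy x hx

/-- A linear functional on `ℝ^V` is the dot product with the vector of its values on the coordinate
vectors. [folklore] -/
private theorem linear_eq_dotProduct [DecidableEq V] (f : (V → ℝ) →ₗ[ℝ] ℝ) (x : V → ℝ) :
    f x = x ⬝ᵥ fun i => f (Pi.single i 1) := by
  conv_lhs => rw [show x = ∑ i, x i • (Pi.single i (1 : ℝ) : V → ℝ) from by
    funext j; simp [Finset.sum_apply, Pi.single_apply]]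
  rw [map_sum]
  simp only [map_smul, smul_eq_mul, dotProduct]

/-- **`(C^*)^* = C` for a closed convex cone** (the bipolar theorem for cones; Averkov: "`(X^*)^* =
cl(cone(X))`"), by geometric Hahn–Banach. [cite: Averkov2019, §3.2 (p08)] -/
theorem dualCone_dualCone {C : Set (V → ℝ)} (hCconv : Convex ℝ C) (hCclosed : IsClosed C) (h0 : (0 : V → ℝ) ∈ C)
    (hCsmul : ∀ x ∈ C, ∀ t : ℝ, 0 ≤ t → t • x ∈ C) : dualCone (dualCone C) = C := by
  classical
  refine Set.Subset.antisymm (fun z hz => ?_) (subset_dualCone_dualCone C)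
  by_contra hzC
  obtain ⟨f, a, hfa, haz⟩ := geometric_hahn_banach_closed_point hCconv hCclosed hzC
  -- `f ≤ 0` on the cone `C` and `0 < a < f z`
  have ha0 : 0 < a := by simpa using hfa 0 h0
  have hfC : ∀ x ∈ C, f x ≤ 0 := by
    intro x hx
    by_contra hpos
    push Not at hpos
    have h := hfa ((a / f x + 1) • x) (hCsmul x hx _ (by positivity))
    rw [map_smul, smul_eq_mul, add_mul, div_mul_cancel₀ _ hpos.ne', one_mul] at h
    linarith
  -- the vector `y = −(f(e_i))_i` lies in `C^*` and pairs negatively with `z`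
  set y : V → ℝ := -fun i => f (Pi.single i 1) with hy
  have hfy : ∀ x : V → ℝ, f x = -(x ⬝ᵥ y) := fun x => by
    rw [hy, dotProduct_neg, neg_neg]; exact linear_eq_dotProduct f.toLinearMap x
  have hyC : y ∈ dualCone C := fun x hx => by
    have := hfC x hx; rw [hfy] at this; linarith
  have h1 := hz y hyC
  rw [dotProduct_comm] at h1
  have h2 : f z = -(z ⬝ᵥ y) := hfy z
  linarith

omit [Fintype V] in
/-- The cone generated by a set: `{t • y : t ≥ 0, y ∈ S}` (no convex hull taken). [folklore] -/
def coneHull (S : Set (V → ℝ)) : Set (V → ℝ) := {z | ∃ t : ℝ, 0 ≤ t ∧ ∃ y ∈ S, z = t • y}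

omit [Fintype V] in
/-- Membership in `coneHull`. [folklore] -/
private theorem mem_coneHull_iff {S : Set (V → ℝ)} {z : V → ℝ} :
    z ∈ coneHull S ↔ ∃ t : ℝ, 0 ≤ t ∧ ∃ y ∈ S, z = t • y := Iff.rfl

/-! ### §2 Homogenisation keeps `(S^d_+)^r`-lifts (block version of the tree's `HasPsdLift.coneOver`) -/

omit [Fintype V] in
/-- A ray `{t • y₁ : t ≥ 0}` has an `(S^d_+)^r`-lift for `d, r ≥ 1` (`π(M) = (M_1)_{11} · y₁`).
[cite: GouveiaParriloThomas2013, Def. 2.2 (§2)] -/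
theorem hasBlockPsdLift_coneHull_singleton (y₁ : V → ℝ) {d r : ℕ} (hd : 1 ≤ d) (hr : 1 ≤ r) :
    HasBlockPsdLift (coneHull {y₁}) d r := by
  classical
  let i0 : Fin d := ⟨0, hd⟩
  let t0 : Fin r := ⟨0, hr⟩
  let π : (Fin r → Matrix (Fin d) (Fin d) ℝ) →ₗ[ℝ] (V → ℝ) :=
    { toFun := fun M => M t0 i0 i0 • y₁
      map_add' := fun M N => by simp [add_smul]
      map_smul' := fun c M => by simp [smul_smul] }
  refine ⟨⊤, π, Set.ext fun z => ⟨?_, ?_⟩⟩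
  · rintro ⟨t, ht, y, hy, rfl⟩
    rw [Set.mem_singleton_iff.1 hy]
    refine ⟨fun _ => t • (1 : Matrix (Fin d) (Fin d) ℝ), ⟨fun _ => PosSemidef.one.smul ht,
      AffineSubspace.mem_top ℝ _ _⟩, ?_⟩
    change (t • (1 : Matrix (Fin d) (Fin d) ℝ)) i0 i0 • y₁ = t • y₁
    simp
  · rintro ⟨M, ⟨hM, -⟩, rfl⟩
    exact ⟨M t0 i0 i0, (hM t0).diag_nonneg, y₁, rfl, rfl⟩

/-- **Homogenisation keeps `(S^d_+)^r`-lifts.** If a bounded set `S ⊆ ℝ^V` not containing `0` on a ray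
through two of its points… precisely: bounded, with an `(S^d_+)^r`-lift `S = π(K ∩ L)`, and such that the
cone `{t y}` over it contains `0` only as `0 • y` (automatic) — then `coneHull S = {t • y : t ≥ 0, y ∈ S}`
has an `(S^d_+)^r`-lift, namely `π(K ∩ W)` with `W = ℝX₁ + dir L`. Two observations (as in the tree's
`HasPsdLift.coneOver`): a psd direction `D ∈ dir L` has `π D = 0` (else `π(X₁ + sD)` leaves the bounded
`S`), and no psd `Y ∈ W` has negative `X₁`-coordinate (else `S` would be a point — the singleton case is
`hasBlockPsdLift_coneHull_singleton`). [cite: Averkov2019, Remark 20 (p08, cones ↔ compact slices)]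
[cite: GouveiaParriloThomas2013, Def. 2.2 (§2)] -/
theorem HasBlockPsdLift.coneHull {S : Set (V → ℝ)} {d r : ℕ} (h : HasBlockPsdLift S d r)
    (hbdd : Bornology.IsBounded S) (hne : S.Nonempty) (hd : 1 ≤ d) (hr : 1 ≤ r) :
    HasBlockPsdLift (coneHull S) d r := by
  classical
  -- the singleton case
  by_cases hsing : S.Subsingleton
  · obtain ⟨y₁, hy₁⟩ := hne
    have : S = {y₁} := hsing.eq_singleton_of_mem hy₁
    rw [this]
    exact hasBlockPsdLift_coneHull_singleton y₁ hd hr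
  obtain ⟨L, π, rfl⟩ := h
  set K : Set (Fin r → Matrix (Fin d) (Fin d) ℝ) := {M | (∀ t, (M t).PosSemidef) ∧ M ∈ L} with hK
  obtain ⟨_, ⟨X₁, hX₁, rfl⟩, _, ⟨X₂, hX₂, rfl⟩, hne12⟩ :=
    (Set.not_subsingleton_iff.1 hsing : (π '' K).Nontrivial)
  obtain ⟨R, hRpos, hR⟩ := hbdd.subset_closedBall_lt 0 (0 : V → ℝ)
  -- psd directions of `L` are killed by `π`
  have hF3 : ∀ D ∈ L.direction, (∀ t, (D t).PosSemidef) → π D = 0 := by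
    intro D hD hDpsd
    by_contra hπD
    have hpos : 0 < ‖π D‖ := norm_pos_iff.mpr hπD
    set s : ℝ := (R + ‖π X₁‖ + 1) / ‖π D‖ with hs
    have hs0 : 0 ≤ s := by positivity
    have hmem : X₁ + s • D ∈ K := by
      refine ⟨fun t => (hX₁.1 t).add ((hDpsd t).smul hs0), ?_⟩
      have := (AffineSubspace.vadd_mem_iff_mem_direction (s • D) hX₁.2).2 (L.direction.smul_mem s hD)
      rwa [vadd_eq_add, add_comm] at this
    have hball := hR ⟨X₁ + s • D, hmem, rfl⟩
    rw [Metric.mem_closedBall, dist_zero_right, map_add, map_smul] at hball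
    have h1 : ‖s • π D‖ ≤ ‖π X₁ + s • π D‖ + ‖π X₁‖ := by
      have := norm_sub_le (π X₁ + s • π D) (π X₁)
      simpa using this
    rw [norm_smul, Real.norm_eq_abs, abs_of_nonneg hs0] at h1
    have h2 : s * ‖π D‖ = R + ‖π X₁‖ + 1 := by
      rw [hs, div_mul_cancel₀ _ hpos.ne']
    linarith
  -- `X₁` is not a direction of `L`
  have hX₁dir : X₁ ∉ L.direction := by
    intro hX₁V
    have h1 : π X₁ = 0 := hF3 X₁ hX₁V hX₁.1
    have hX₂V : X₂ ∈ L.direction := by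
      have h := AffineSubspace.vsub_mem_direction hX₂.2 hX₁.2
      rw [vsub_eq_sub] at h
      have : X₂ = (X₂ - X₁) + X₁ := by abel
      rw [this]
      exact L.direction.add_mem h hX₁V
    have h2 : π X₂ = 0 := hF3 X₂ hX₂V hX₂.1
    exact hne12 (h1.trans h2.symm)
  -- the functional `f`
  obtain ⟨f₀, hf₀X, hf₀V⟩ := Submodule.exists_dual_map_eq_bot_of_notMem hX₁dir inferInstance
  set f : Module.Dual ℝ (Fin r → Matrix (Fin d) (Fin d) ℝ) := (f₀ X₁)⁻¹ • f₀ with hf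
  have hfX₁ : f X₁ = 1 := by
    rw [hf, LinearMap.smul_apply, smul_eq_mul, inv_mul_cancel₀ hf₀X]
  have hfV : ∀ D ∈ L.direction, f D = 0 := fun D hD => by
    have h : f₀ D ∈ Submodule.map f₀ L.direction := Submodule.mem_map_of_mem hD
    rw [hf₀V] at h
    rw [hf, LinearMap.smul_apply, (Submodule.mem_bot ℝ).mp h, smul_zero]
  have hfL : ∀ X ∈ L, f X = 1 := fun X hX => by
    have h := hfV _ (by
      have := AffineSubspace.vsub_mem_direction hX hX₁.2
      rwa [vsub_eq_sub] at this)
    rw [map_sub, hfX₁, sub_eq_zero] at h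
    exact h
  -- the linear subspace `W = ℝ X₁ + dir L`
  set W : Submodule ℝ (Fin r → Matrix (Fin d) (Fin d) ℝ) := (ℝ ∙ X₁) ⊔ L.direction with hW
  have hWdecomp : ∀ Y ∈ W, Y - f Y • X₁ ∈ L.direction := by
    intro Y hY
    obtain ⟨y, hy, z, hz, rfl⟩ := Submodule.mem_sup.mp hY
    obtain ⟨a, rfl⟩ := Submodule.mem_span_singleton.mp hy
    have : f (a • X₁ + z) = a := by
      rw [map_add, map_smul, hfX₁, hfV z hz, smul_eq_mul, mul_one, add_zero]
    rw [this]
    simpa using hz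
  have hLW : ∀ X ∈ L, X ∈ W := fun X hX => by
    have h : X = X₁ + (X - X₁) := by abel
    rw [h]
    refine W.add_mem (Submodule.mem_sup_left (Submodule.mem_span_singleton_self X₁))
      (Submodule.mem_sup_right ?_)
    have := AffineSubspace.vsub_mem_direction hX hX₁.2
    rwa [vsub_eq_sub] at this
  -- `Y ∈ W` with `f Y ≠ 0` rescales into `L`
  have hrescale : ∀ Y ∈ W, f Y ≠ 0 → (f Y)⁻¹ • Y ∈ L := by
    intro Y hY ht
    have hD := hWdecomp Y hY
    have h : (f Y)⁻¹ • Y = ((f Y)⁻¹ • (Y - f Y • X₁)) +ᵥ X₁ := by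
      rw [vadd_eq_add, smul_sub, smul_smul, inv_mul_cancel₀ ht, one_smul]
      abel
    rw [h]
    exact (AffineSubspace.vadd_mem_iff_mem_direction _ hX₁.2).2 (L.direction.smul_mem _ hD)
  -- no psd `Y` in `W` has `f Y < 0`
  have hF4 : ∀ Y ∈ W, (∀ t, (Y t).PosSemidef) → 0 ≤ f Y := by
    intro Y hY hYpsd
    by_contra hneg
    push Not at hneg
    set Z : Fin r → Matrix (Fin d) (Fin d) ℝ := (f Y)⁻¹ • Y with hZ
    have hZL : Z ∈ L := hrescale Y hY hneg.ne
    have hZneg : ∀ t, ((-Z) t).PosSemidef := fun t => by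
      rw [hZ, ← neg_smul, Pi.smul_apply]
      exact (hYpsd t).smul (by rw [neg_nonneg]; exact (inv_lt_zero.mpr hneg).le)
    have hπ : ∀ X ∈ K, π X = π Z := by
      intro X hX
      have hdir : X - Z ∈ L.direction := by
        have := AffineSubspace.vsub_mem_direction hX.2 hZL
        rwa [vsub_eq_sub] at this
      have hpsd : ∀ t, ((X - Z) t).PosSemidef := fun t => by
        rw [sub_eq_add_neg, Pi.add_apply]; exact (hX.1 t).add (hZneg t)
      have := hF3 _ hdir hpsd
      rwa [map_sub, sub_eq_zero] at this
    exact hne12 ((hπ X₁ hX₁).trans (hπ X₂ hX₂).symm)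
  refine ⟨W.toAffineSubspace, π, Set.ext fun z => ⟨?_, ?_⟩⟩
  · -- cone ⊆ image
    rintro ⟨s, hs, _, ⟨X, hX, rfl⟩, rfl⟩
    refine ⟨s • X, ⟨fun t => (hX.1 t).smul hs, ?_⟩, (map_smul π s X).symm ▸ rfl⟩
    exact Submodule.mem_toAffineSubspace.mpr (W.smul_mem s (hLW X hX.2))
  · -- image ⊆ cone
    rintro ⟨Y, ⟨hYpsd, hYW⟩, rfl⟩
    have hYW' : Y ∈ W := Submodule.mem_toAffineSubspace.mp hYW
    have ht := hF4 Y hYW' hYpsd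
    rcases ht.eq_or_lt with ht0 | htpos
    · -- `f Y = 0`: `Y` is a psd direction, `π Y = 0`
      have hYdir : Y ∈ L.direction := by
        have := hWdecomp Y hYW'
        rwa [← ht0, zero_smul, sub_zero] at this
      have hπY : π Y = 0 := hF3 Y hYdir hYpsd
      refine ⟨0, le_rfl, π X₁, ⟨X₁, hX₁, rfl⟩, ?_⟩
      rw [hπY, zero_smul]
    · -- `f Y = t > 0`: rescale into `L`
      set t : ℝ := f Y with htdef
      have hXL : t⁻¹ • Y ∈ L := hrescale Y hYW' htpos.ne'
      have hXpsd : ∀ s, ((t⁻¹ • Y) s).PosSemidef := fun s => by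
        rw [Pi.smul_apply]; exact (hYpsd s).smul (inv_pos.mpr htpos).le
      refine ⟨t, htpos.le, π (t⁻¹ • Y), ⟨t⁻¹ • Y, ⟨hXpsd, hXL⟩, rfl⟩, ?_⟩
      rw [map_smul, smul_smul, mul_inv_cancel₀ htpos.ne', one_smul]

/-! ### §3 Pointedness and interior points -/

/-- The dot product with a fixed vector as a linear functional. [folklore] -/
def dotFun (u : V → ℝ) : (V → ℝ) →ₗ[ℝ] ℝ where
  toFun x := u ⬝ᵥ x
  map_add' x y := dotProduct_add u x y
  map_smul' c x := by rw [dotProduct_smul]; rfl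

/-- The affine hyperplane `{x : ⟨u, x⟩ = 1}`. [cite: Averkov2019, §3.2 (p08, "bounded affine slice")] -/
def sliceOne (u : V → ℝ) : AffineSubspace ℝ (V → ℝ) :=
  (AffineSubspace.mk' (1 : ℝ) (⊥ : Submodule ℝ ℝ)).comap (dotFun u).toAffineMap

/-- Membership in the slice. [cite: Averkov2019, §3.2 (p08)] -/
theorem mem_sliceOne_iff (u x : V → ℝ) : x ∈ (sliceOne u : Set (V → ℝ)) ↔ u ⬝ᵥ x = 1 := by
  change x ∈ sliceOne u ↔ _
  rw [sliceOne, AffineSubspace.mem_comap, AffineSubspace.mem_mk', Submodule.mem_bot, vsub_eq_sub,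
    sub_eq_zero]
  rfl

/-- `|⟨x, y⟩| ≤ |V| · ‖x‖ · ‖y‖` in the sup norms of `ℝ^V`. [folklore] -/
private theorem abs_dotProduct_le (x y : V → ℝ) : |x ⬝ᵥ y| ≤ Fintype.card V * ‖x‖ * ‖y‖ := by
  calc |x ⬝ᵥ y| = |∑ i, x i * y i| := rfl
    _ ≤ ∑ i, |x i * y i| := Finset.abs_sum_le_sum_abs _ _
    _ ≤ ∑ _i : V, ‖x‖ * ‖y‖ := Finset.sum_le_sum fun i _ => by
        rw [abs_mul]
        exact mul_le_mul (by simpa using norm_le_pi_norm x i) (by simpa using norm_le_pi_norm y i)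
          (abs_nonneg _) (norm_nonneg _)
    _ = Fintype.card V * ‖x‖ * ‖y‖ := by rw [Finset.sum_const, Finset.card_univ, nsmul_eq_mul, mul_assoc]

/-- **Pointed + closed ⇒ quantitatively pointed**: for a closed cone `C` (closed under nonnegative scaling)
that is pointed by `u`, there is `c > 0` with `c‖x‖ ≤ ⟨u, x⟩` on `C` (minimum of `⟨u, ·⟩` on the compact
`C ∩` unit sphere); hence the slice `C ∩ {⟨u, x⟩ = 1}` is bounded. [cite: Averkov2019, §3.2 (p08, "then {x ∈ C : ⟨u,x⟩ = 1} is a bounded affine slice of C")] -/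
theorem exists_pos_mul_norm_le_of_pointed {C : Set (V → ℝ)} (hCclosed : IsClosed C)
    (hCsmul : ∀ x ∈ C, ∀ t : ℝ, 0 ≤ t → t • x ∈ C) {u : V → ℝ} (hu : ∀ x ∈ C, 0 ≤ u ⬝ᵥ x)
    (hu0 : ∀ x ∈ C, u ⬝ᵥ x = 0 → x = 0) : ∃ c : ℝ, 0 < c ∧ ∀ x ∈ C, c * ‖x‖ ≤ u ⬝ᵥ x := by
  set S : Set (V → ℝ) := C ∩ sphere 0 1 with hS
  by_cases hSe : S.Nonempty
  · have hScpt : IsCompact S := (isCompact_sphere (0 : V → ℝ) 1).of_isClosed_subset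
      (hCclosed.inter isClosed_sphere) Set.inter_subset_right
    have hcont : ContinuousOn (fun x : V → ℝ => u ⬝ᵥ x) S :=
      (Continuous.dotProduct continuous_const continuous_id).continuousOn
    obtain ⟨xm, hxmS, hmin⟩ := hScpt.exists_isMinOn hSe hcont
    have hxm1 : ‖xm‖ = 1 := by simpa using hxmS.2
    have hcpos : 0 < u ⬝ᵥ xm := by
      rcases (hu xm hxmS.1).eq_or_lt with h0 | hpos
      · have := hu0 xm hxmS.1 h0.symm
        rw [this, norm_zero] at hxm1
        exact absurd hxm1 zero_ne_one
      · exact hpos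
    refine ⟨u ⬝ᵥ xm, hcpos, fun x hx => ?_⟩
    by_cases hx0 : x = 0
    · rw [hx0, norm_zero, mul_zero, dotProduct_zero]
    have hnpos : 0 < ‖x‖ := norm_pos_iff.mpr hx0
    have hxS : ‖x‖⁻¹ • x ∈ S := by
      refine ⟨hCsmul x hx _ (inv_nonneg.mpr hnpos.le), ?_⟩
      rw [mem_sphere_zero_iff_norm, norm_smul, Real.norm_of_nonneg (inv_nonneg.mpr hnpos.le),
        inv_mul_cancel₀ hnpos.ne']
    have h : u ⬝ᵥ xm ≤ u ⬝ᵥ (‖x‖⁻¹ • x) := hmin hxS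
    rw [dotProduct_smul, smul_eq_mul] at h
    have := mul_le_mul_of_nonneg_left h hnpos.le
    rwa [← mul_assoc, mul_inv_cancel₀ hnpos.ne', one_mul, mul_comm] at this
  · -- `C ⊆ {0}`: any `c` works
    refine ⟨1, one_pos, fun x hx => ?_⟩
    by_cases hx0 : x = 0
    · rw [hx0, norm_zero, mul_zero, dotProduct_zero]
    · exfalso
      have hnpos : 0 < ‖x‖ := norm_pos_iff.mpr hx0
      refine hSe ⟨‖x‖⁻¹ • x, hCsmul x hx _ (inv_nonneg.mpr hnpos.le), ?_⟩
      rw [mem_sphere_zero_iff_norm, norm_smul, Real.norm_of_nonneg (inv_nonneg.mpr hnpos.le),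
        inv_mul_cancel₀ hnpos.ne']

/-- An interior point of `C` comes with coordinate moves `x₀ ± ε e_i ∈ C`. [folklore] -/
private theorem exists_ball_of_mem_interior [DecidableEq V] {C : Set (V → ℝ)} {x₀ : V → ℝ}
    (hx₀ : x₀ ∈ interior C) :
    ∃ ε : ℝ, 0 < ε ∧ ∀ z : V → ℝ, ‖z‖ ≤ ε → x₀ + z ∈ C := by
  obtain ⟨δ, hδ, hball⟩ := Metric.mem_nhds_iff.1 (mem_interior_iff_mem_nhds.1 hx₀)
  refine ⟨δ / 2, by positivity, fun z hz => hball ?_⟩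
  rw [Metric.mem_ball, dist_eq_norm, add_sub_cancel_left]
  linarith

/-- **Full-dimensional ⇒ dual pointed** (quantitatively): if `x₀ ∈ int C` then `ε‖y‖ ≤ ⟨x₀, y⟩` on `C^*`;
in particular `⟨x₀, y⟩ = 0` forces `y = 0`, and the slice `C^* ∩ {⟨x₀, ·⟩ = 1}` is bounded.
[cite: Averkov2019, §3.2 (p08)] -/
theorem dualCone_pointed_of_interior [DecidableEq V] {C : Set (V → ℝ)} {x₀ : V → ℝ}
    (hx₀ : x₀ ∈ interior C) : ∃ ε : ℝ, 0 < ε ∧ ∀ y ∈ dualCone C, ε * ‖y‖ ≤ x₀ ⬝ᵥ y := by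
  obtain ⟨ε, hε, hmove⟩ := exists_ball_of_mem_interior hx₀
  refine ⟨ε, hε, fun y hy => ?_⟩
  have h0 : 0 ≤ x₀ ⬝ᵥ y := hy x₀ (interior_subset hx₀)
  have key : ∀ i, |y i| ≤ x₀ ⬝ᵥ y / ε := by
    intro i
    have hn : ‖(Pi.single i ε : V → ℝ)‖ ≤ ε := by rw [Pi.norm_single, Real.norm_of_nonneg hε.le]
    have h1 := hy _ (hmove (Pi.single i ε) hn)
    have h2 := hy _ (hmove (-Pi.single i ε) (by rwa [norm_neg]))
    rw [add_dotProduct, single_dotProduct] at h1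
    rw [add_dotProduct, neg_dotProduct, single_dotProduct] at h2
    rw [le_div_iff₀ hε]
    have habs : |y i| * ε = |y i * ε| := by rw [abs_mul, abs_of_pos hε]
    rw [habs, abs_le]
    constructor <;> linarith
  have h := (pi_norm_le_iff_of_nonneg (div_nonneg h0 hε.le)).2 fun i => by
    rw [Real.norm_eq_abs]; exact key i
  rwa [le_div_iff₀ hε, mul_comm] at h

/-- **Pointed ⇒ dual full-dimensional**: if `c‖x‖ ≤ ⟨u, x⟩` on `C` (`c > 0`) then `u` is an interior point
of `C^*` (the ball of radius `c/(|V|+1)` around `u` lies in `C^*`). [cite: Averkov2019, §3.2 (p08)] -/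
theorem mem_interior_dualCone_of_pointed {C : Set (V → ℝ)} {u : V → ℝ} {c : ℝ} (hc : 0 < c)
    (hcx : ∀ x ∈ C, c * ‖x‖ ≤ u ⬝ᵥ x) : u ∈ interior (dualCone C) := by
  rw [mem_interior_iff_mem_nhds, Metric.mem_nhds_iff]
  refine ⟨c / (Fintype.card V + 1), by positivity, fun y hy x hx => ?_⟩
  rw [Metric.mem_ball, dist_eq_norm] at hy
  have h1 := hcx x hx
  have h2 := abs_dotProduct_le x (y - u)
  have h3 : x ⬝ᵥ y = u ⬝ᵥ x + x ⬝ᵥ (y - u) := by rw [dotProduct_sub, dotProduct_comm x u]; ring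
  rw [h3]
  have h4 : -(x ⬝ᵥ (y - u)) ≤ Fintype.card V * ‖x‖ * ‖y - u‖ := (neg_le_abs _).trans h2
  have h5 : (Fintype.card V : ℝ) * ‖x‖ * ‖y - u‖ ≤ Fintype.card V * ‖x‖ * (c / (Fintype.card V + 1)) :=
    mul_le_mul_of_nonneg_left hy.le (by positivity)
  have h6 : (Fintype.card V : ℝ) * (c / (Fintype.card V + 1)) ≤ c := by
    rw [mul_div_assoc', div_le_iff₀ (by positivity)]
    nlinarith
  have h7 : (Fintype.card V : ℝ) * ‖x‖ * (c / (Fintype.card V + 1)) ≤ c * ‖x‖ := by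
    have := mul_le_mul_of_nonneg_left h6 (norm_nonneg x)
    calc (Fintype.card V : ℝ) * ‖x‖ * (c / (Fintype.card V + 1))
        = ‖x‖ * ((Fintype.card V : ℝ) * (c / (Fintype.card V + 1))) := by ring
      _ ≤ ‖x‖ * c := this
      _ = c * ‖x‖ := mul_comm _ _
  linarith

/-! ### §4 Averkov (2.1)–(2.2): the dual of a lifted pointed full-dimensional closed convex cone is lifted -/

/-- **Theorem 19 ⇒ (2.1)/(2.2), one direction, for pointed full-dimensional closed convex cones.** If a
closed cone `C ⊆ ℝ^V` (closed under nonnegative scaling), pointed (Averkov: `⟨u, x⟩ ≥ 0` on `C` and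
`{x ∈ C : ⟨u, x⟩ = 0} = {0}`) and with non-empty interior, has an `(S^d_+)^r`-lift, then its dual cone
`C^*` has an `(S^d_+)^r`-lift — same block size `d` AND same number of blocks `r`. Route: Remark 20 (pass to
the bounded slices `C ∩ {⟨u,·⟩ = 1}`, `C^* ∩ {⟨x₀,·⟩ = 1}`), Theorem 19 (i) ⇒ (ii) on the slices via the
tree's `HasBlockPsdLift.hasPsdPowerFactorization_slack`, (ii) ⇒ (i) for the dual slice via
`exists_hasBlockPsdLift_between`, and homogenisation `HasBlockPsdLift.coneHull`.
[cite: Averkov2019, Thm. 19, Remark 20, Remark 21 (p08) and (2.1)–(2.2) (p06)]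
[cite: GouveiaParriloThomas2013, Thm. 2.4 and Prop. 2.8 (2) (§2)] -/
theorem hasBlockPsdLift_dualCone [DecidableEq V] {C : Set (V → ℝ)} {d r : ℕ} (hC : HasBlockPsdLift C d r)
    (hCclosed : IsClosed C) (hCsmul : ∀ x ∈ C, ∀ t : ℝ, 0 ≤ t → t • x ∈ C)
    (hpt : ∃ u : V → ℝ, (∀ x ∈ C, 0 ≤ u ⬝ᵥ x) ∧ ∀ x ∈ C, u ⬝ᵥ x = 0 → x = 0)
    (hint : (interior C).Nonempty) : HasBlockPsdLift (dualCone C) d r := by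
  classical
  -- empty coordinate type: everything is `{0}`
  rcases isEmpty_or_nonempty V with hV | hV
  · have h0D : (0 : V → ℝ) ∈ dualCone C := fun x _ => by rw [dotProduct_zero]
    have hD : dualCone C = {0} :=
      Set.eq_singleton_iff_unique_mem.2 ⟨h0D, fun y _ => funext fun i => isEmptyElim i⟩
    rw [hD]; exact hasBlockPsdLift_zero_singleton d r
  obtain ⟨x₀, hx₀⟩ := hint
  have hx₀C : x₀ ∈ C := interior_subset hx₀
  obtain ⟨δ, hδ, hmove⟩ := exists_ball_of_mem_interior hx₀
  obtain ⟨ε, hε, hεy⟩ := dualCone_pointed_of_interior hx₀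
  -- a nonzero point of `C`
  obtain ⟨i₀⟩ := hV
  have hC1 : ∃ x₁ ∈ C, x₁ ≠ 0 := by
    by_cases h : x₀ = 0
    · refine ⟨x₀ + Pi.single i₀ δ, hmove _ (by rw [Pi.norm_single, Real.norm_of_nonneg hδ.le]), ?_⟩
      rw [h, zero_add]
      intro h'
      have := congrFun h' i₀
      simp only [Pi.single_eq_same, Pi.zero_apply] at this
      exact hδ.ne' this
    · exact ⟨x₀, hx₀C, h⟩
  -- degenerate block parameters are impossible
  by_cases h0 : d = 0 ∨ r = 0
  · exfalso
    obtain ⟨x₁, hx₁C, hx₁⟩ := hC1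
    exact hx₁ (Set.mem_singleton_iff.1 (hC.subset_zero_of_eq_zero h0 hx₁C))
  push Not at h0
  have hd : 1 ≤ d := Nat.one_le_iff_ne_zero.2 h0.1
  have hr : 1 ≤ r := Nat.one_le_iff_ne_zero.2 h0.2
  obtain ⟨u, hu, hu0⟩ := hpt
  obtain ⟨c, hc, hcx⟩ := exists_pos_mul_norm_le_of_pointed hCclosed hCsmul hu hu0
  -- the slices `B = C ∩ {⟨u,·⟩ = 1}` and `B' = C^* ∩ {⟨x₀,·⟩ = 1}`
  set B : Set (V → ℝ) := C ∩ (sliceOne u : Set (V → ℝ)) with hB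
  set B' : Set (V → ℝ) := dualCone C ∩ (sliceOne x₀ : Set (V → ℝ)) with hB'
  have hBlift : HasBlockPsdLift B d r := hC.inter_affineSubspace (sliceOne u)
  have hBbdd : Bornology.IsBounded B := by
    rw [isBounded_iff_forall_norm_le]
    refine ⟨c⁻¹, fun x hx => ?_⟩
    have h1 := hcx x hx.1
    rw [(mem_sliceOne_iff u x).1 hx.2] at h1
    calc ‖x‖ = c⁻¹ * (c * ‖x‖) := by field_simp
      _ ≤ c⁻¹ * 1 := mul_le_mul_of_nonneg_left h1 (inv_nonneg.2 hc.le)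
      _ = c⁻¹ := mul_one _
  -- membership in `C^*` may be tested on `B` (`C` is the cone over `B`)
  have hdual_of_B : ∀ y : V → ℝ, (∀ x ∈ B, 0 ≤ x ⬝ᵥ y) → y ∈ dualCone C := by
    intro y hy x hx
    rcases (hu x hx).eq_or_lt with h0' | hpos
    · rw [hu0 x hx h0'.symm, zero_dotProduct]
    · have hxB : (u ⬝ᵥ x)⁻¹ • x ∈ B := by
        refine ⟨hCsmul x hx _ (inv_nonneg.2 hpos.le), (mem_sliceOne_iff u _).2 ?_⟩
        rw [dotProduct_smul, smul_eq_mul, inv_mul_cancel₀ hpos.ne']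
      have h := hy _ hxB
      rw [smul_dotProduct, smul_eq_mul] at h
      exact (mul_nonneg_iff_of_pos_left (inv_pos.2 hpos)).1 h
  -- Theorem 19 (i) ⇒ (ii) on the slices: `⟨x, y⟩ = Σ_t ⟨A_{x,t}, B_{y,t}⟩` for `x ∈ B`, `y ∈ B'`
  have hfac : HasPsdPowerFactorization
      (fun (x : B) (y : B') => (0 : ℝ) - (-((y : V → ℝ))) ⬝ᵥ (x : V → ℝ)) d r :=
    hBlift.hasPsdPowerFactorization_slack (x := fun x : B => (x : V → ℝ))
      (a := fun y : B' => -((y : V → ℝ))) (b := fun _ => (0 : ℝ)) hd hr hBbdd (fun x => x.2)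
      (fun z hz y => by rw [neg_dotProduct, neg_nonpos, dotProduct_comm]; exact y.2.1 z hz.1)
  obtain ⟨A, Bm, hA, hBm, hS⟩ := hfac
  -- transposed, as the slack of `B'` against `⟨x, ·⟩ ≥ 0` (`x ∈ B`) and the slice equation (two rows)
  let a' : B ⊕ Fin 2 → (V → ℝ) := Sum.elim (fun x => -((x : V → ℝ))) ![x₀, -x₀]
  let b' : B ⊕ Fin 2 → ℝ := Sum.elim (fun _ => 0) ![1, -1]
  have hfac' : HasPsdPowerFactorization
      (fun (y : B') (j : B ⊕ Fin 2) => b' j - a' j ⬝ᵥ (y : V → ℝ)) d r := by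
    refine ⟨Bm, Sum.elim A (fun _ _ => 0), hBm, fun j t => ?_, fun y j => ?_⟩
    · cases j with
      | inl x => exact hA x t
      | inr k => exact PosSemidef.zero
    · have hy1 : x₀ ⬝ᵥ (y : V → ℝ) = 1 := (mem_sliceOne_iff x₀ y).1 y.2.2
      cases j with
      | inl x =>
        have h := hS x y
        change (0 : ℝ) - (-((y : V → ℝ))) ⬝ᵥ (x : V → ℝ) = ∑ t, (A x t * Bm y t).trace at h
        change (0 : ℝ) - (-((x : V → ℝ))) ⬝ᵥ (y : V → ℝ) = ∑ t, (Bm y t * A x t).trace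
        rw [neg_dotProduct, dotProduct_comm] at h
        rw [neg_dotProduct, h]
        exact Finset.sum_congr rfl fun t _ => Matrix.trace_mul_comm _ _
      | inr k =>
        change b' (Sum.inr k) - a' (Sum.inr k) ⬝ᵥ (y : V → ℝ) = ∑ t, (Bm y t * 0).trace
        fin_cases k <;> simp [a', b', neg_dotProduct, hy1]
  -- the target polyhedron of the between-theorem is exactly `B'`, and it is bounded
  have hQ : {y : V → ℝ | ∀ j, a' j ⬝ᵥ y ≤ b' j} = B' := by
    ext y
    constructor
    · intro h
      have h1 : ∀ x ∈ B, 0 ≤ x ⬝ᵥ y := fun x hx => by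
        have h' := h (Sum.inl ⟨x, hx⟩)
        change -((x : V → ℝ)) ⬝ᵥ y ≤ 0 at h'
        rw [neg_dotProduct] at h'
        linarith
      have h2 := h (Sum.inr 0)
      have h3 := h (Sum.inr 1)
      change x₀ ⬝ᵥ y ≤ 1 at h2
      change (-x₀) ⬝ᵥ y ≤ -1 at h3
      rw [neg_dotProduct] at h3
      exact ⟨hdual_of_B y h1, (mem_sliceOne_iff x₀ y).2 (by linarith)⟩
    · rintro ⟨hyD, hy1⟩
      have hy1' : x₀ ⬝ᵥ y = 1 := (mem_sliceOne_iff x₀ y).1 hy1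
      rintro (⟨x, hx⟩ | k)
      · change -((x : V → ℝ)) ⬝ᵥ y ≤ 0
        rw [neg_dotProduct, neg_nonpos]
        exact hyD x hx.1
      · fin_cases k
        · change x₀ ⬝ᵥ y ≤ 1
          rw [hy1']
        · change (-x₀) ⬝ᵥ y ≤ -1
          rw [neg_dotProduct, hy1']
  have hB'bdd : Bornology.IsBounded B' := by
    rw [isBounded_iff_forall_norm_le]
    refine ⟨ε⁻¹, fun y hy => ?_⟩
    have h1 := hεy y hy.1
    rw [(mem_sliceOne_iff x₀ y).1 hy.2] at h1
    calc ‖y‖ = ε⁻¹ * (ε * ‖y‖) := by field_simp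
      _ ≤ ε⁻¹ * 1 := mul_le_mul_of_nonneg_left h1 (inv_nonneg.2 hε.le)
      _ = ε⁻¹ := mul_one _
  -- (ii) ⇒ (i) for the dual slice
  obtain ⟨C', hconv, hC'Q, hlift⟩ := hfac'.exists_hasBlockPsdLift_between
    (x := fun y : B' => (y : V → ℝ)) (a := a') (b := b') hd hr (by rw [hQ]; exact hB'bdd)
  have hB'C' : B' ⊆ C' := fun y hy => hconv (subset_convexHull ℝ _ ⟨⟨y, hy⟩, rfl⟩)
  have hC'B' : C' ⊆ B' := hC'Q.trans hQ.le
  have hB'lift : HasBlockPsdLift B' d r := by rwa [Set.Subset.antisymm hC'B' hB'C'] at hlift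
  -- `B'` is non-empty: `u ∈ C^* ∖ {0}` rescales into it
  obtain ⟨x₁, hx₁C, hx₁⟩ := hC1
  have hune : u ≠ 0 := by
    intro hu'
    have h1 := hcx x₁ hx₁C
    rw [hu', zero_dotProduct] at h1
    have : ‖x₁‖ ≤ 0 := by nlinarith [norm_nonneg x₁]
    exact hx₁ (norm_eq_zero.1 (le_antisymm this (norm_nonneg _)))
  have huD : u ∈ dualCone C := fun x hx => by rw [dotProduct_comm]; exact hu x hx
  have hx₀u : 0 < x₀ ⬝ᵥ u := lt_of_lt_of_le (mul_pos hε (norm_pos_iff.2 hune)) (hεy u huD)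
  have hB'ne : B'.Nonempty := ⟨(x₀ ⬝ᵥ u)⁻¹ • u, smul_mem_dualCone huD (inv_nonneg.2 hx₀u.le),
    (mem_sliceOne_iff x₀ _).2 (by rw [dotProduct_smul, smul_eq_mul, inv_mul_cancel₀ hx₀u.ne'])⟩
  -- `C^*` is the cone over `B'`
  have hcone : dualCone C = coneHull B' := by
    ext y
    constructor
    · intro hy
      rcases (hy x₀ hx₀C).eq_or_lt with h0' | hpos
      · have hy0 : y = 0 := by
          have h1 := hεy y hy
          rw [← h0'] at h1
          have : ‖y‖ ≤ 0 := by nlinarith [norm_nonneg y]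
          exact norm_eq_zero.1 (le_antisymm this (norm_nonneg _))
        obtain ⟨y₁, hy₁⟩ := hB'ne
        exact ⟨0, le_rfl, y₁, hy₁, by rw [hy0, zero_smul]⟩
      · refine ⟨x₀ ⬝ᵥ y, hpos.le, (x₀ ⬝ᵥ y)⁻¹ • y, ⟨smul_mem_dualCone hy (inv_nonneg.2 hpos.le),
          (mem_sliceOne_iff x₀ _).2 ?_⟩, ?_⟩
        · rw [dotProduct_smul, smul_eq_mul, inv_mul_cancel₀ hpos.ne']
        · rw [smul_smul, mul_inv_cancel₀ hpos.ne', one_smul]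
    · rintro ⟨t, ht, y', hy', rfl⟩
      exact smul_mem_dualCone hy'.1 ht
  rw [hcone]
  exact hB'lift.coneHull hB'bdd hB'ne hd hr

/-- **Averkov 2019, (2.1) and (2.2), for pointed full-dimensional closed convex cones**: `C^*` has an
`(S^d_+)^r`-lift iff `C` does (so `sxc(C^*) = sxc(C)`, the case `r = 1`, and `sxd(C^*) = sxd(C)`). The
converse direction applies the theorem to `C^*` — closed, pointed by an interior point of `C`
(`dualCone_pointed_of_interior`), with interior point `u` (`mem_interior_dualCone_of_pointed`) — and
returns through `(C^*)^* = C` (`dualCone_dualCone`). [cite: Averkov2019, (2.1)–(2.2) (p06) and Remark 21 (p08)] -/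
theorem hasBlockPsdLift_dualCone_iff [DecidableEq V] {C : Set (V → ℝ)} {d r : ℕ} (hCconv : Convex ℝ C)
    (hCclosed : IsClosed C) (hCsmul : ∀ x ∈ C, ∀ t : ℝ, 0 ≤ t → t • x ∈ C)
    (hpt : ∃ u : V → ℝ, (∀ x ∈ C, 0 ≤ u ⬝ᵥ x) ∧ ∀ x ∈ C, u ⬝ᵥ x = 0 → x = 0)
    (hint : (interior C).Nonempty) :
    HasBlockPsdLift (dualCone C) d r ↔ HasBlockPsdLift C d r := by
  refine ⟨fun h => ?_, fun h => hasBlockPsdLift_dualCone h hCclosed hCsmul hpt hint⟩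
  obtain ⟨x₀, hx₀⟩ := hint
  have h0C : (0 : V → ℝ) ∈ C := by simpa using hCsmul x₀ (interior_subset hx₀) 0 le_rfl
  obtain ⟨u, hu, hu0⟩ := hpt
  obtain ⟨c, hc, hcx⟩ := exists_pos_mul_norm_le_of_pointed hCclosed hCsmul hu hu0
  obtain ⟨ε, hε, hεy⟩ := dualCone_pointed_of_interior hx₀
  have h' := hasBlockPsdLift_dualCone h (isClosed_dualCone C) (fun y hy t ht => smul_mem_dualCone hy ht)
    ⟨x₀, fun y hy => hy x₀ (interior_subset hx₀), fun y hy hy0 => by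
      have h1 := hεy y hy
      rw [hy0] at h1
      have : ‖y‖ ≤ 0 := by nlinarith [norm_nonneg y]
      exact norm_eq_zero.1 (le_antisymm this (norm_nonneg _))⟩
    ⟨u, mem_interior_dualCone_of_pointed hc hcx⟩
  rwa [dualCone_dualCone hCconv hCclosed h0C hCsmul] at h'

end Literature.Combinatorics.Optimization
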